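import Literature.NumberTheory.Rogawski1990.LocalTransferTransport   -- ★ `OrbitalMeasureFamily.transport`, `classOrbitalIntegral_transport`, `stableOrbitalIntegralRel_transport`, `preClass`, `isConj_apply_out_preClass`, `map_preClass`, `preClass_map`
import HarnessLib

/-!
# R90-TF · S3 wave 4 (J-S3-3) — THE GENERIC HEART OF BRICK G2: the transfer relation `f ↦ f^H` (4.3.1) TRANSPORTS along a pair of group isomorphisms
# (`IsDeltaTransferRel` for the transported orbital measure families, the transported functions and a transfer factor that agrees on the image)

Cell `hodgecm-mathlib`, crux H413 (`stmt-HodgeConjecture-24833`), route of record `HCCMUnconditional`; programme R90-TF, section S3 (base `R90-C12`), wave 4 «LOCAL TRANSPORT»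
(S3-R12; LEAD #33 (C), #35 (D): «K2E4-p14 FIRST CLAIM — G2 `IsLocalDeltaTransfer(+Exists)` transport iff»; R90-C12-typ1 (g3) HEADBYTES 22:55:37Z, socket
`stub_R90_S3_transport_deltaTransfer` of `Cruxes/H413/Lines/R90_S3_LocalTransportWaveG.lean` :122).  Seat K2E4-p14 (g11).  Lane `--supports stmt-HodgeConjecture-24833 --as helper`;
THEOREMS ONLY (no definition, no instance, no notation, no `sorry`); ★-only imports (no `Cruxes/…/Lines`).

THE MATHEMATICS [Rogawski1990 §4.3 (4.3.1) p. 43; §14.2 p. 232; Gelbart1975 §10 pp. 154–155].  ★ `IsDeltaTransferRel R stA regA T mH mG fH f` says: for every `regA`-regular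
`γ_H ∈ A`, `Φ^st_A(γ_H, f^H; mH) = Σᶠ_{[γ] ∈ ConjClasses B} Δ(γ_H, γ)·Φ([γ], f; mG)`.  Let `ψ_A : A ≃* A′`, `ψ_B : B ≃* B′` be bicontinuous isomorphisms and transport
everything: the families `ψ_{A*} mH`, `ψ_{B*} mG` (★ `OrbitalMeasureFamily.transport`), the functions `f^H ∘ ψ_A⁻¹`, `f ∘ ψ_B⁻¹`, regularity and stable conjugacy INTERTWINED by
`ψ_A` (`regA′ (ψ_A a) ↔ regA a`, `stA′ (ψ_A a) (ψ_A a₂) ↔ stA a a₂`, both stable conjugacies class functions in the second variable), and a transfer factor `T′` on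
`(A′, B′)` AGREEING with `T` on the image, `Δ′(ψ_A γ_H, ψ_B γ) = Δ(γ_H, γ)` (the content of brick G1 at the explicit factor of §4.9; here a hypothesis `hΔ`).  Then
**`IsDeltaTransferRel R′ stA′ regA′ T′ (ψ_{A*} mH) (ψ_{B*} mG) (f^H ∘ ψ_A⁻¹) (f ∘ ψ_B⁻¹) ↔ IsDeltaTransferRel R stA regA T mH mG f^H f`**: the stable side transports by
★ `stableOrbitalIntegralRel_transport`; on the unstable side each class orbital integral transports EXACTLY (★ `classOrbitalIntegral_transport`:
`Φ([out c′], f ∘ ψ_B⁻¹; ψ_{B*} mG) = Φ([out (ψ_B⁻¹ c′)], f; mG)`), the factor at the chosen representative `out c′ ~ ψ_B (out (ψ_B⁻¹ c′))` (★ `isConj_apply_out_preClass`)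
is moved by `T′.conj_right` and `hΔ`, and the `finsum` over `ConjClasses B′` is re-indexed along the bijection `c′ ↦ ψ_B⁻¹ c′` (★ `map_preClass` ∕ `preClass_map`).
* §1 `Δ_out_transport` (the factor at representatives), `finsum_transport` (re-indexing the unstable side), **`isDeltaTransferRel_transport_iff`** (+ the two directions
  `IsDeltaTransferRel.transport`, `IsDeltaTransferRel.of_transport`).
The CM instance (brick G2 proper: `A = H_v`, `B = U(H′)_v`, `ψ = (e_H, e₃)` from the ring-level currency `Φ`, `T, T′ = finExplicitCollection …`, `hΔ` = socket G1,
`regA = IsLocalGRegular`, `stA = IsLocalStablyConjH` with their `GL.map Φ`-invariance) is the assembly file `Theorems/R90S3TransportDeltaTransfer.lean` over this lemma.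
HONEST LABEL: HC_CM is proved only modulo the 7 printed citations (2 remaining named inputs: hLiu418 = stmt-HodgeConjecture-24832, h413 = stmt-HodgeConjecture-24833) until rung 0
closes; this file is transport-of-structure bookkeeping, no print input.

## References
* [Rogawski1990] J. D. Rogawski, *Automorphic Representations of Unitary Groups in Three Variables*, Ann. of Math. Stud. 123 (1990), §4.3 (4.3.1) p. 43; §14.2 (14.2.1) p. 232
  («if `v ∉ S`, (14.2.1) is obviously satisfied» — transport along an identification).
* [Gelbart1975] S. Gelbart, *Automorphic forms on adele groups*, Ann. of Math. Stud. 83 (1975), §10 pp. 154–155 (orbital integrals matched class by class along `G_S = G′_S`).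
-/

set_option autoImplicit false
-- the mandated namespace repeats the single-problem summit's segment (`HodgeConjecture.HodgeConjecture`)
set_option linter.dupNamespace false

noncomputable section

open MeasureTheory Topology
open Literature.NumberTheory.Rogawski1990 Literature.NumberTheory.Automorphic

namespace Summit.HodgeConjecture.HodgeConjecture.R90.S3

universe u₁ u₂ u₃ u₄

variable {A : Type u₁} {B : Type u₂} {A' : Type u₃} {B' : Type u₄} [Group A] [Group B] [Group A'] [Group B']
  [TopologicalSpace A] [TopologicalSpace B] [TopologicalSpace A'] [TopologicalSpace B'] [IsTopologicalGroup A'] [IsTopologicalGroup B']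
  [∀ a : A, MeasurableSpace (A ⧸ Subgroup.centralizer ({a} : Set A))] [∀ a : A, BorelSpace (A ⧸ Subgroup.centralizer ({a} : Set A))]
  [∀ b : B, MeasurableSpace (B ⧸ Subgroup.centralizer ({b} : Set B))] [∀ b : B, BorelSpace (B ⧸ Subgroup.centralizer ({b} : Set B))]
  [∀ a : A', MeasurableSpace (A' ⧸ Subgroup.centralizer ({a} : Set A'))] [∀ a : A', BorelSpace (A' ⧸ Subgroup.centralizer ({a} : Set A'))]
  [∀ b : B', MeasurableSpace (B' ⧸ Subgroup.centralizer ({b} : Set B'))] [∀ b : B', BorelSpace (B' ⧸ Subgroup.centralizer ({b} : Set B'))]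
  (ψA : A ≃* A') (hψA : Continuous ψA) (hψAs : Continuous ψA.symm)
  (ψB : B ≃* B') (hψB : Continuous ψB) (hψBs : Continuous ψB.symm)
  {R : A → B → Prop} {R' : A' → B' → Prop}

/-! ## §1 Transport of (4.3.1) along `(ψ_A, ψ_B)` -/

omit [TopologicalSpace A] [TopologicalSpace B] [TopologicalSpace A'] [TopologicalSpace B'] [IsTopologicalGroup A'] [IsTopologicalGroup B']
  [∀ a : A, MeasurableSpace (A ⧸ Subgroup.centralizer ({a} : Set A))] [∀ a : A, BorelSpace (A ⧸ Subgroup.centralizer ({a} : Set A))]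
  [∀ b : B, MeasurableSpace (B ⧸ Subgroup.centralizer ({b} : Set B))] [∀ b : B, BorelSpace (B ⧸ Subgroup.centralizer ({b} : Set B))]
  [∀ a : A', MeasurableSpace (A' ⧸ Subgroup.centralizer ({a} : Set A'))] [∀ a : A', BorelSpace (A' ⧸ Subgroup.centralizer ({a} : Set A'))]
  [∀ b : B', MeasurableSpace (B' ⧸ Subgroup.centralizer ({b} : Set B'))] [∀ b : B', BorelSpace (B' ⧸ Subgroup.centralizer ({b} : Set B'))] in
/-- **The transfer factor at chosen representatives**: if `Δ′(ψ_A a, ψ_B b) = Δ(a, b)` for all `(a, b)`, then for every class `c′` of `B′`,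
`Δ′(ψ_A a, out c′) = Δ(a, out (ψ_B⁻¹ c′))` — `out c′` is conjugate to `ψ_B (out (ψ_B⁻¹ c′))` (★ `isConj_apply_out_preClass`) and `Δ′` is a class function in the
second variable (`conj_right`). [cite: Rogawski1990, §4.3 p. 43] -/
theorem Δ_out_transport (T : TransferFactorData A B R) (T' : TransferFactorData A' B' R')
    (hΔ : ∀ (a : A) (b : B), T'.Δ (ψA a) (ψB b) = T.Δ a b) (a : A) (c' : ConjClasses B') :
    T'.Δ (ψA a) (Quotient.out c' : B') = T.Δ a (Quotient.out (preClass ψB c') : B) := by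
  obtain ⟨y, hy⟩ := isConj_iff.1 (isConj_apply_out_preClass ψB c')
  rw [← hy, T'.conj_right, hΔ]

omit [TopologicalSpace A] [TopologicalSpace A'] [IsTopologicalGroup A']
  [∀ a : A, MeasurableSpace (A ⧸ Subgroup.centralizer ({a} : Set A))] [∀ a : A, BorelSpace (A ⧸ Subgroup.centralizer ({a} : Set A))]
  [∀ a : A', MeasurableSpace (A' ⧸ Subgroup.centralizer ({a} : Set A'))] [∀ a : A', BorelSpace (A' ⧸ Subgroup.centralizer ({a} : Set A'))] in
/-- **Re-indexing the unstable side** along `c′ ↦ ψ_B⁻¹ c′`: `Σᶠ_{c′} Δ′(ψ_A a, out c′)·Φ([c′], f ∘ ψ_B⁻¹; ψ_{B*} mG) = Σᶠ_{c} Δ(a, out c)·Φ([c], f; mG)`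
(★ `classOrbitalIntegral_transport`, `Δ_out_transport`, and the bijection ★ `map_preClass` ∕ `preClass_map`). [cite: Gelbart1975, §10 pp. 154–155] [cite: Rogawski1990, §4.3 (4.3.1) p. 43] -/
theorem finsum_transport (T : TransferFactorData A B R) (T' : TransferFactorData A' B' R')
    (hΔ : ∀ (a : A) (b : B), T'.Δ (ψA a) (ψB b) = T.Δ a b) (mG : OrbitalMeasureFamily B) (f : B → ℂ) (a : A) :
    ∑ᶠ c' : ConjClasses B', T'.Δ (ψA a) (Quotient.out c' : B') * classOrbitalIntegral (mG.transport ψB hψB hψBs) (f ∘ ψB.symm) c' =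
      ∑ᶠ c : ConjClasses B, T.Δ a (Quotient.out c : B) * classOrbitalIntegral mG f c := by
  have hterm : ∀ c' : ConjClasses B',
      T'.Δ (ψA a) (Quotient.out c' : B') * classOrbitalIntegral (mG.transport ψB hψB hψBs) (f ∘ ψB.symm) c' =
        T.Δ a (Quotient.out (preClass ψB c') : B) * classOrbitalIntegral mG f (preClass ψB c') := by
    intro c'
    rw [Δ_out_transport ψA ψB T T' hΔ a c', classOrbitalIntegral_transport ψB hψB hψBs mG (f ∘ ψB.symm) c']
    have hf : (f ∘ ψB.symm) ∘ ψB = f := by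
      funext b
      simp only [Function.comp_apply, MulEquiv.symm_apply_apply]
    rw [hf]
  simp_rw [hterm]
  refine finsum_eq_of_bijective (fun c' : ConjClasses B' => preClass ψB c') ⟨fun c₁ c₂ h => ?_, fun c => ⟨c.map ψB.toMonoidHom, preClass_map ψB c⟩⟩ fun _ => rfl
  have h' : preClass ψB c₁ = preClass ψB c₂ := h
  rw [← map_preClass ψB c₁, ← map_preClass ψB c₂, h']

/-- **(4.3.1) TRANSPORTS ALONG A PAIR OF BICONTINUOUS GROUP ISOMORPHISMS** (`→` direction is `IsDeltaTransferRel.transport`, `←` is `.of_transport`): with regularity and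
stable conjugacy on the `H`-side INTERTWINED by `ψ_A` (and both stable conjugacies class functions in the second variable) and the transfer factors AGREEING on the image
(`hΔ`, brick G1's content), `f ↦ f^H` holds for the transported data iff it holds for the original data. [cite: Rogawski1990, §4.3 (4.3.1) p. 43; §14.2 (14.2.1) p. 232] [cite: Gelbart1975, §10 pp. 154–155] -/
theorem isDeltaTransferRel_transport_iff (stA : A → A → Prop) (stA' : A' → A' → Prop) (regA : A → Prop) (regA' : A' → Prop)
    (hst : ∀ a a₂ : A, stA a a₂ ↔ stA' (ψA a) (ψA a₂))
    (hcl : ∀ (a y y' : A), IsConj y y' → (stA a y ↔ stA a y')) (hcl' : ∀ (a y y' : A'), IsConj y y' → (stA' a y ↔ stA' a y'))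
    (hreg : ∀ a : A, regA' (ψA a) ↔ regA a)
    (T : TransferFactorData A B R) (T' : TransferFactorData A' B' R') (hΔ : ∀ (a : A) (b : B), T'.Δ (ψA a) (ψB b) = T.Δ a b)
    (mH : OrbitalMeasureFamily A) (mG : OrbitalMeasureFamily B) (fH : A → ℂ) (f : B → ℂ) :
    IsDeltaTransferRel R' stA' regA' T' (mH.transport ψA hψA hψAs) (mG.transport ψB hψB hψBs) (fH ∘ ψA.symm) (f ∘ ψB.symm) ↔
      IsDeltaTransferRel R stA regA T mH mG fH f := by
  have hfH : (fH ∘ ψA.symm) ∘ ψA = fH := by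
    funext a
    simp only [Function.comp_apply, MulEquiv.symm_apply_apply]
  -- the stable side at `ψ_A a` is the stable side at `a`
  have hstab : ∀ a : A, stableOrbitalIntegralRel stA' (mH.transport ψA hψA hψAs) (fH ∘ ψA.symm) (ψA a) = stableOrbitalIntegralRel stA mH fH a := by
    intro a
    rw [stableOrbitalIntegralRel_transport ψA hψA hψAs stA' stA hst hcl' hcl mH (fH ∘ ψA.symm) a, hfH]
  constructor
  · intro h a ha
    have h1 := h (ψA a) ((hreg a).2 ha)
    rw [hstab a, finsum_transport ψA ψB hψB hψBs T T' hΔ mG f a] at h1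
    exact h1
  · intro h a' ha'
    obtain ⟨a, rfl⟩ := ψA.surjective a'
    rw [hstab a, finsum_transport ψA ψB hψB hψBs T T' hΔ mG f a]
    exact h a ((hreg a).1 ha')

/-- `→` of `isDeltaTransferRel_transport_iff`, named. [cite: Rogawski1990, §4.3 (4.3.1) p. 43; §14.2 (14.2.1) p. 232] -/
theorem IsDeltaTransferRel.of_transport {stA : A → A → Prop} {stA' : A' → A' → Prop} {regA : A → Prop} {regA' : A' → Prop}
    (hst : ∀ a a₂ : A, stA a a₂ ↔ stA' (ψA a) (ψA a₂))
    (hcl : ∀ (a y y' : A), IsConj y y' → (stA a y ↔ stA a y')) (hcl' : ∀ (a y y' : A'), IsConj y y' → (stA' a y ↔ stA' a y'))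
    (hreg : ∀ a : A, regA' (ψA a) ↔ regA a)
    {T : TransferFactorData A B R} {T' : TransferFactorData A' B' R'} (hΔ : ∀ (a : A) (b : B), T'.Δ (ψA a) (ψB b) = T.Δ a b)
    {mH : OrbitalMeasureFamily A} {mG : OrbitalMeasureFamily B} {fH : A → ℂ} {f : B → ℂ}
    (h : IsDeltaTransferRel R' stA' regA' T' (mH.transport ψA hψA hψAs) (mG.transport ψB hψB hψBs) (fH ∘ ψA.symm) (f ∘ ψB.symm)) :
    IsDeltaTransferRel R stA regA T mH mG fH f :=
  (isDeltaTransferRel_transport_iff ψA hψA hψAs ψB hψB hψBs stA stA' regA regA' hst hcl hcl' hreg T T' hΔ mH mG fH f).1 h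

/-- `←` of `isDeltaTransferRel_transport_iff`, named. [cite: Rogawski1990, §4.3 (4.3.1) p. 43; §14.2 (14.2.1) p. 232] -/
theorem IsDeltaTransferRel.transport {stA : A → A → Prop} {stA' : A' → A' → Prop} {regA : A → Prop} {regA' : A' → Prop}
    (hst : ∀ a a₂ : A, stA a a₂ ↔ stA' (ψA a) (ψA a₂))
    (hcl : ∀ (a y y' : A), IsConj y y' → (stA a y ↔ stA a y')) (hcl' : ∀ (a y y' : A'), IsConj y y' → (stA' a y ↔ stA' a y'))
    (hreg : ∀ a : A, regA' (ψA a) ↔ regA a)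
    {T : TransferFactorData A B R} {T' : TransferFactorData A' B' R'} (hΔ : ∀ (a : A) (b : B), T'.Δ (ψA a) (ψB b) = T.Δ a b)
    {mH : OrbitalMeasureFamily A} {mG : OrbitalMeasureFamily B} {fH : A → ℂ} {f : B → ℂ}
    (h : IsDeltaTransferRel R stA regA T mH mG fH f) :
    IsDeltaTransferRel R' stA' regA' T' (mH.transport ψA hψA hψAs) (mG.transport ψB hψB hψBs) (fH ∘ ψA.symm) (f ∘ ψB.symm) :=
  (isDeltaTransferRel_transport_iff ψA hψA hψAs ψB hψB hψBs stA stA' regA regA' hst hcl hcl' hreg T T' hΔ mH mG fH f).2 h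

end Summit.HodgeConjecture.HodgeConjecture.R90.S3

end
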